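import Mathlib.Algebra.BigOperators.Ring.Finset
import Mathlib.Algebra.Order.BigOperators.Group.Finset
import Mathlib.Data.Fintype.BigOperators
import Mathlib.Logic.Function.Basic
import Mathlib.Logic.Equiv.Defs
import HarnessLib

/-!
# Re-indexing sums through one block of a seed (support for hybrid arguments)

Topic `Computability/Complexity`. Generic toolkit for the hybrid arguments of the Nisan–Wigderson /
Impagliazzo–Wigderson reconstruction proofs (planned consumers: `IWAmpHybrid.lean`,
`NWExtraction.lean` of this directory): a seed `z : α → γ` is split into the content of one block
`range u` (`u : β ↪ α`) and the rest, via Mathlib's `Function.extend u x z` ("overwrite the block by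
`x`"), the randomness `ω : ι → Ω` into one position and the rest, via `Function.update`, and sums are
re-indexed accordingly (Nisan–Wigderson 1994, proof of Lemma 2.4: "fix the bits of the seed outside
`Sᵢ`"; Arora–Barak 2009, proof of Lemma 20.15). All statements are elementary and proved, for an
arbitrary finite alphabet `γ` and summands in any `NonAssocSemiring R`:

* `extend_involutive`, `extendPerm` — `(z, x) ↦ (extend u x z, z ∘ u)` is an involution;
* `sum_sum_extend` — `∑_z ∑_x g(extend u x z) = |β → γ| · ∑_z g(z)`;
* `sum_sum_update` — `∑_{ω} ∑_o G(update ω i o) = |Ω| · ∑_ω G(ω)`;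
* `exists_sum_le_card_nsmul` — some index attains at least the mean.

Special cases already in the tree, to be consolidated onto this file by a librarian dedupe (one
line each; this file is import-light so that all of them can import it):
* `Literature.Computability.MetaComplexity.sum_sum_extend` (`MetaComplexity/NWGenerator.lean`:
  `γ = Bool`, `R = ℝ`) and `overwrite_involutive` there — instances of `sum_sum_extend` /
  `extend_involutive`;
* `Literature.Combinatorics.Enumerative.sum_overwrite_eq` (`OverwritePositions.lean`, `Fin`-indexed
  blocks, `CommSemiring`) — the `Fin` relative of `sum_sum_extend`;
* `Literature.Combinatorics.Enumerative.updateEquiv` / `sum_update_eq` (`OverwritePositions.lean`,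
  domain `Fin m`) — the `Fin` case of `sum_sum_update`; further one-position re-indexings of the same
  kind: `NWGenerator.sum_eq_half_sum_update`, `OracleSeparationBQPPH.sum_eq_sum_sum_update_div`,
  `CliffordGaussSums.sum_update_eq_two_mul`, `AaronsonAmbainisProofs.sum_update_add_sum_update`
  (each `Ω = Bool` or a two-term split, derivable from `sum_sum_update`).

## References

* N. Nisan, A. Wigderson, *Hardness vs randomness*, JCSS 49 (1994), proof of Lemma 2.4.
* S. Arora, B. Barak, *Computational Complexity: A Modern Approach*, CUP 2009, proof of Lemma 20.15
  [AroraBarak2009].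
-/

namespace Literature.Computability.Complexity

open Finset

namespace BlockOverwrite

variable {α β γ : Type*}

/-- Overwriting the block `range u` of `z` by `x` and remembering the old block is an involution
of `(α → γ) × (β → γ)`. [cite: AroraBarak2009, proof of Lemma 20.15 (fixing the seed outside Sᵢ)] -/
theorem extend_involutive (u : β ↪ α) :
    Function.Involutive (fun p : (α → γ) × (β → γ) => (Function.extend u p.2 p.1, p.1 ∘ u)) := by
  rintro ⟨z, x⟩
  simp only [Prod.mk.injEq]
  constructor
  · funext a
    by_cases h : ∃ k, u k = a
    · obtain ⟨k, rfl⟩ := h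
      rw [u.injective.extend_apply]; rfl
    · rw [Function.extend_apply' _ _ _ h, Function.extend_apply' _ _ _ h]
  · exact Function.extend_comp u.injective _ _

/-- The involution of `extend_involutive` as a permutation. [folklore] -/
noncomputable def extendPerm (u : β ↪ α) : Equiv.Perm ((α → γ) × (β → γ)) :=
  (extend_involutive (γ := γ) u).toPerm _

/-- **Re-indexing a sum through a block**: every seed `z` is `extend u x z₀` for exactly `|β → γ|`
pairs `(z₀, x)`. [cite: AroraBarak2009, proof of Lemma 20.15] -/
theorem sum_sum_extend {R : Type*} [NonAssocSemiring R] [Fintype α] [DecidableEq α] [Fintype β]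
    [DecidableEq β] [Fintype γ] (u : β ↪ α) (g : (α → γ) → R) :
    (∑ z : α → γ, ∑ x : β → γ, g (Function.extend u x z)) =
      (Fintype.card (β → γ) : R) * ∑ z : α → γ, g z := by
  let Ψ : Equiv.Perm ((α → γ) × (β → γ)) := extendPerm u
  calc (∑ z : α → γ, ∑ x : β → γ, g (Function.extend u x z))
      = ∑ p : (α → γ) × (β → γ), g (Ψ p).1 := by
        rw [Fintype.sum_prod_type]; rfl
    _ = ∑ p : (α → γ) × (β → γ), g p.1 :=
        Equiv.sum_comp Ψ (fun p : (α → γ) × (β → γ) => g p.1)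
    _ = (Fintype.card (β → γ) : R) * ∑ z : α → γ, g z := by
        rw [Fintype.sum_prod_type]
        simp only [Finset.sum_const, Finset.card_univ, nsmul_eq_mul]
        rw [Finset.mul_sum]

/-- **Re-indexing a sum through one position**: every `ω` is `update ω₀ i o` for exactly `|Ω|` pairs
`(ω₀, o)`. [folklore] -/
theorem sum_sum_update {ι Ω R : Type*} [Fintype ι] [DecidableEq ι] [Fintype Ω] [NonAssocSemiring R]
    (i : ι) (G : (ι → Ω) → R) :
    ∑ ωo : ι → Ω, ∑ o : Ω, G (Function.update ωo i o) = (Fintype.card Ω : R) * ∑ ω, G ω := by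
  classical
  let Ψ : (ι → Ω) × Ω ≃ (ι → Ω) × Ω :=
    { toFun := fun p => (Function.update p.1 i p.2, p.1 i)
      invFun := fun q => (Function.update q.1 i q.2, q.1 i)
      left_inv := fun p => by simp
      right_inv := fun q => by simp }
  rw [← Fintype.sum_prod_type' (f := fun ωo o => G (Function.update ωo i o))]
  rw [show (∑ p : (ι → Ω) × Ω, G (Function.update p.1 i p.2)) = ∑ p, G ((Ψ p).1) from rfl]
  rw [Equiv.sum_comp Ψ (fun q => G q.1), Fintype.sum_prod_type]
  simp only [sum_const, card_univ, nsmul_eq_mul]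
  rw [Finset.mul_sum]

/-- Averaging: some index attains at least the mean, `∑ g ≤ |α| • g a`. [folklore] -/
theorem exists_sum_le_card_nsmul {ι M : Type*} [Fintype ι] [Nonempty ι] [AddCommMonoid M] [LinearOrder M]
    [IsOrderedCancelAddMonoid M] (g : ι → M) : ∃ a, ∑ b, g b ≤ Fintype.card ι • g a := by
  have h : ∑ _a : ι, (∑ b, g b) = ∑ a, Fintype.card ι • g a := by
    rw [sum_const, card_univ, ← Finset.sum_nsmul]
  obtain ⟨a, -, ha⟩ := Finset.exists_le_of_sum_le univ_nonempty h.le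
  exact ⟨a, ha⟩

end BlockOverwrite

end Literature.Computability.Complexity
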